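/- Copyright: the b2b-balaban cell (near-miss cell 7), T⁴-continuum fan-out; row NE7b CRUX team (2), seat
t4-ne7b-formalise-leaf-03 (gen 27) — custodian's READING-SIDE build of the OWNER's INTERFACE REQUEST NE7b IR-49-1 «THE FIBRE
DECORATION» (RULING R-OWNER-49-1 (c)∕(e), journal l.33471): the displays (ρ0)–(ρ3) of a reading and the one-liner discharging
the located display (ρ) `FibreMass` through the owner's M5-5 `HistoryBankingFibreResum` (p288991).  Released under the licence
of the surrounding project. -/
import Summits.QuantumFields.BalabanUV.T4Continuum.Support.HistoryRealiseCellsRunAssemblyWTVSData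
import Summits.QuantumFields.BalabanUV.T4Continuum.Support.HistoryBankingFibreResum

/-!
# THE FIBRE DECORATION OF A READING: (ρ) `FibreMass` ⇐ (ρ0) ∧ (ρ1) ∧ (ρ2) ∧ [(ρ3) KERNEL modulo «FIBRE-1»] (IR-49-1, reading side)
(re-open object (α) of row NE7b; lineage `t4-ne7b-formalise-leaf-03` gen 27, custodian of the S12-W crew; E-side key
readings for (ρ1) = leaf-02's part)

Summits-side support leaf of the T⁴-continuum cell (rung (B)+1 on a FINITE torus only; NOT infinite volume, NOT the
mass gap, NOT the Clay statement; NOT a proof of the spine estimate NE7b — the cell's OWN estimate, NOT PRINTED, NOT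
PROVED).  [folklore] ONE `structure` (a hypothesis SHAPE — data + located displays, R-class, NOTHING of Bałaban's asserted)
and by-name composition with the owner's M5-5 `HistoryBankingFibreResum` (`fibreMass_of_decoration`,
`card_fibre_le_of_decoration`, `card_le_exp_nsum_of_le_ncount`, `ncount`) over the S12-W supply modules
(`HistoryRealiseCellsRunSupplyWTVS.dmassOf`, `memOf`∕`kmemOf` at `ℛ.inputOf.pedV`∕`liveCV`, `badGMems`, `fibre`, `MULTOf`,
`sharpT`); no `[cite:]` tag, no `Prop` fact minted, zero `sorry`.  B16 = [Balaban1989LargeFieldII] pp. 378–390 — LOCATORS ONLY.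

WHY (R-OWNER-49-1).  The (α) records `HistReadDataL` (p283718) ∕ `HistReadDataLW` (p289955) display (ρ) `FibreMass` as ONE
volume-type inequality NOT-IN-PRINT: `hρ : ∑ τ ∈ fibre kmem T K k, dmassOf ℛ Φf t τ ≤ W K * MULTOf (sharpT (φB K) (φR K)) k`
for every bad key class.  The owner's M5-5 proves that shape in the abstract from three primitive inputs — an injective
slice + decoration of the key fibre, a factorisation of the mass with a slice envelope, per-member decoration masses
within `exp (nsum φ ·)` — and proves print's p. 383 counting sentence with the O(1) explicit (`ncount_le_exp_nsum`).  This
file is the READING-SIDE instantiation: it states those inputs as located displays ON THE READING `ℛ`, `Φf` (`IndexDecor`)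
and derives `hρ` verbatim, so that a later record twin can REPLACE the field `hρ` by `IndexDecor` (net: −1 volume-type
inequality, +2 structural readings with locators, +1 share inequality on letters — NEEDS-CONSTANT «FIBRE-1»).

WHAT.  §1 **`structure IndexDecor ℛ Φf l₀ K₀ W φB φR cellOf phys jstar δ κ`**: data `Dec`, `dec`, `Csl`, `slice`, `v`, `N`
and the displays `died_empty` (ρ0), `hsl`∕`hmem`∕`hinj` (ρ1), `v_nonneg`∕`envelope`∕`hW` (ρ2), `card_Dec`∕`hN` (ρ3) — generic
in the root-cell ∕ physical maps and the cut.  §2 `dmassOf_eq_of_died_empty` ((ρ0) in the kernel: dead part `= 1`).  §3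
**`fibreMass_of_indexDecor`** (THE JUNCTION: (ρ) from `IndexDecor` by `fibreMass_of_decoration` at crude weights `u := 1`)
and `card_fibre_le_of_indexDecor` (the pure count, for the census).  §4 **`hρ_of_indexDecor`**: the conclusion VERBATIM
the type of `HistReadDataL.hρ` at the (α) carriers `cellA`∕`physA`∕`jhalf`.

HONEST SCOPE.  (ρ) is NOT proved for Bałaban's densities: it is RELOCATED onto (ρ0) [pp. 378–379, D-46-1], (ρ1) the index
reading [p. 378 (1.71); its KEY-SIDE reading on `HIndex`'s `(a, h, ℓ, c)` is leaf-02's E-side module], (ρ2) the curly ∕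
tree-decay envelope [pp. 388–390] (T∕PARAMETRIC), all R-class displays, and (ρ3) KERNEL modulo the share check «FIBRE-1»
(refuter ∕ balaban-calc).  NE7b NOT proved; spine 0∕9.  HONEST DEPENDENCY (cell): continuum YM on T⁴ ⇐ BetaPertH ∧ nine
spine estimates (0/9 proved); BetaPertH ⇐ (D1) ∧ (D4) ∧ CAP+tail; G-an2-4 gates asym, D1 and NE2/3/4.  Unchanged here.
-/

open Finset MeasureTheory
open Literature.MathematicalPhysics.QuantumFieldTheory.Balaban1983to89
open T4PersistenceDictionary T4PersistentHistoryCount T4BankedInduction T4PrintedShapeBanking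
open T4WeightBudget T4GlobalDenominator T4LiveClassFibration T4LiveStructureGas T4LiveGasToTerms T4RecordPriceSeam
open T4PartnerMultiplicity T4IndicatorShell T4MatchingAssembly T4MatchingClosure T4MatchingClosureSocket T4Continuum
open T4StabilitySocket T4BranchingRecordsGas T4TaggedShapeBanking T4CanonicalMenus T4RenewalChains
open Summit.QuantumFields.BalabanUV.T4Continuum.PlacementBatch Summit.QuantumFields.BalabanUV.T4Continuum.PlacementSkeleton
open Summit.QuantumFields.BalabanUV.T4Continuum.CountThresholdUniform Summit.QuantumFields.BalabanUV.T4Continuum.CountThresholdExit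
open Summit.QuantumFields.BalabanUV.T4Continuum.CountSeamJunction Summit.QuantumFields.BalabanUV.T4Continuum.LateMergers
open Summit.QuantumFields.BalabanUV.T4Continuum.HistoryFlow Summit.QuantumFields.BalabanUV.T4Continuum.HistoryRegeneration
open Summit.QuantumFields.BalabanUV.T4Continuum.HistoryTables Summit.QuantumFields.BalabanUV.T4Continuum.HistoryAssemblyTrees
open Summit.QuantumFields.BalabanUV.T4Continuum.HistoryAssemblyTerms Summit.QuantumFields.BalabanUV.T4Continuum.HistoryAssemblyPedigree
open Summit.QuantumFields.BalabanUV.T4Continuum.HistoryConstants Summit.QuantumFields.BalabanUV.T4Continuum.HistoryGen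
open Literature.MathematicalPhysics.QuantumFieldTheory.Balaban1983to89.B13ScaleTransfer
open Summit.QuantumFields.BalabanUV.T4Continuum.ZoneSkeleton Summit.QuantumFields.BalabanUV.T4Continuum.HistorySocketTH
open Summit.QuantumFields.BalabanUV.T4Continuum.HistoryCaps Summit.QuantumFields.BalabanUV.T4Continuum.HistoryAssemblyPrice
open Summit.QuantumFields.BalabanUV.T4Continuum.HistoryBankingLE Summit.QuantumFields.BalabanUV.T4Continuum.HistoryExitLE
open Summit.QuantumFields.BalabanUV.T4Continuum.HistoryAssemblyTreesLE Summit.QuantumFields.BalabanUV.T4Continuum.HistoryAssemblyTermsLE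
open Summit.QuantumFields.BalabanUV.T4Continuum.HistoryRealise Summit.QuantumFields.BalabanUV.T4Continuum.HistoryAssemblyRealiseLE
open Summit.QuantumFields.BalabanUV.T4Continuum.HistoryAssemblyMult Summit.QuantumFields.BalabanUV.T4Continuum.HistoryAssemblyMultKey
open Summit.QuantumFields.BalabanUV.T4Continuum.HistoryAssemblyRealiseRun Summit.QuantumFields.BalabanUV.T4Continuum.HistoryAssemblyRealiseMult
open Summit.QuantumFields.BalabanUV.T4Continuum.HistoryZones Summit.QuantumFields.BalabanUV.T4Continuum.HistoryRealiseCells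
open Summit.QuantumFields.BalabanUV.T4Continuum.HistoryRealiseCellsRun Summit.QuantumFields.BalabanUV.T4Continuum.HistoryAssemblyRealiseRunMult
open Summit.QuantumFields.BalabanUV.T4Continuum.HistoryRealiseCellsRunMult Summit.QuantumFields.BalabanUV.T4Continuum.HistoryAssemblyMultInstance
open Summit.QuantumFields.BalabanUV.T4Continuum.HistoryJoinsPlacedMember Summit.QuantumFields.BalabanUV.T4Continuum.PlacementSkeleton
open Summit.QuantumFields.BalabanUV.T4Continuum.HistoryJoinsPlacedMult Summit.QuantumFields.BalabanUV.T4Continuum.HistoryRealiseDistinct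
open Summit.QuantumFields.BalabanUV.T4Continuum.HistoryRegionTemplates Summit.QuantumFields.BalabanUV.T4Continuum.HistoryCaps
open Summit.QuantumFields.BalabanUV.T4Continuum.HistoryZoneEvolve (cth)
open Literature.MathematicalPhysics.QuantumFieldTheory.Balaban1983to89.B16SProfile (DropCtl)
open Summit.QuantumFields.BalabanUV.T4Continuum.HistoryRealiseCellsRunMultEnd Summit.QuantumFields.BalabanUV.T4Continuum.HistoryRealiseCellsRunMultEndD
open Summit.QuantumFields.BalabanUV.T4Continuum.HistoryRealiseCellsRunPinnedT3b Summit.QuantumFields.BalabanUV.T4Continuum.HistoryHybridRescale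
open Summit.QuantumFields.BalabanUV.T4Continuum.HistoryRealiseCellsRunApex (exists_const_schemeZ)
open Summit.QuantumFields.BalabanUV.T4Continuum.HistoryRealisePrint Summit.QuantumFields.BalabanUV.T4Continuum.HistoryRealiseWeak
open Summit.QuantumFields.BalabanUV.T4Continuum.HistoryRealisePrintReading Summit.QuantumFields.BalabanUV.T4Continuum.HistoryRealiseWeakReading
open Summit.QuantumFields.BalabanUV.T4Continuum.HistoryRealisePrintCells Summit.QuantumFields.BalabanUV.T4Continuum.HistoryRealiseWeakCells
open Summit.QuantumFields.BalabanUV.T4Continuum.HistoryRealiseCellsRunApexT3b Summit.QuantumFields.BalabanUV.T4Continuum.HistoryRealiseCellsRunApexT3bW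

open Summit.QuantumFields.BalabanUV.T4Continuum.HistoryRealiseCellsRunApexT3bWT Summit.QuantumFields.BalabanUV.T4Continuum.HistoryRealiseCellsRunPinnedT3bWT
open Summit.QuantumFields.BalabanUV.T4Continuum.HistoryRealiseCellsRunHeadlineT3bWT
open Summit.QuantumFields.BalabanUV.T4Continuum.HistoryRealiseCellsRunApexT3bWTV Summit.QuantumFields.BalabanUV.T4Continuum.HistoryBankingVolumePlug
open Summit.QuantumFields.BalabanUV.T4Continuum.HistoryRealiseCellsRunApexT3bWTVS
open Summit.QuantumFields.BalabanUV.T4Continuum.HistoryGenealogyRealise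
open Summit.QuantumFields.BalabanUV.T4Continuum.HistoryGenealogyInstantiate
open Summit.QuantumFields.BalabanUV.T4Continuum.B16HistoryIndexedRepr
open Summit.QuantumFields.BalabanUV.T4Continuum.B16HistoryIndexedTrunc
open Summit.QuantumFields.BalabanUV.T4Continuum.HistoryBankingDiscountCharge
open Summit.QuantumFields.BalabanUV.T4Continuum.HistoryBankingCreditRead
open Summit.QuantumFields.BalabanUV.T4Continuum.HistoryBankingFibreRoom
open Summit.QuantumFields.BalabanUV.T4Continuum.HistoryPriceKeys
open Summit.QuantumFields.BalabanUV.T4Continuum.HistoryRealiseCellsRunSupplyWTVS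
open Summit.QuantumFields.BalabanUV.T4Continuum.HistoryRealiseCellsRunSupplyKeysWTVS

open Summit.QuantumFields.BalabanUV.T4Continuum.HistoryRealiseCellsRunAssemblyWTVSData
open Summit.QuantumFields.BalabanUV.T4Continuum.HistoryRealiseCellsRunAssemblyWTVSData
open Summit.QuantumFields.BalabanUV.T4Continuum.HistoryBankingFibreResum
open Summit.QuantumFields.BalabanUV.T4Continuum.HistoryBankingForestVolume (treeVol)
open Summit.QuantumFields.BalabanUV.T4Continuum.HistoryGenealogyExtraction (evProd)
open Summit.QuantumFields.BalabanUV.T4Continuum.HistoryPriceNodeSum (nsum)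

namespace Summit.QuantumFields.BalabanUV.T4Continuum.HistoryRealiseCellsRunSupplyFibreWTVS

noncomputable section

set_option synthInstance.maxSize 1024

variable {DomK : ℕ → Type*} {I : (K : ℕ) → HIndex (DomK K)} {d : ℕ} {γ δ' : Type*} [DecidableEq γ] [DecidableEq δ']

/-! ## §1 The displays (ρ0) (ρ1) (ρ2) (ρ3) of a reading: `IndexDecor` -/

/-- **THE FIBRE DECORATION OF A READING** (R-OWNER-49-1 (c)∕(e), IR-49-1; HYPOTHESIS SHAPE — data + located displays,
R-class, NOTHING of Bałaban's asserted).  Over M2 brick B's reading `ℛ` with factor data `Φf`, at the pass-V carriers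
`ped := ℛ.inputOf.pedV`, `liveC := ℛ.inputOf.liveCV` and ANY root-cell ∕ physical maps `cellOf`, `phys` and cut `jstar`
(the (α) record's are `cellA`, `physA`, `jhalf`), for cutoffs `K ≥ K₀` and sources `|t| ≤ l₀`:
* (ρ0) «NO DEAD INDICES» [B16 pp. 378–379, D-46-1]: on read terms the dissolved process has no component that died before
  the cutoff — `histV.died j = ∅` for `j < K` —, so the dead-part product `DEAD(τ)` of `dmassOf` is `1`;
* (ρ1) «THE INDEX READING» [B16 p. 378 (1.71)]: every term `τ` of the key fibre of a bad key class `k` carries a SLICE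
  `slice K k τ ∈ Csl K k` (its outer summand and curly summand) and, for every member `w ∈ k`, a DECORATION
  `dec K τ w ∈ Dec K w` (the member's internal admissible-sequence data), and slice + decorations DETERMINE the term;
* (ρ2) «THE CURLY ENVELOPE» [B16 pp. 388–390, (1.90)∕(1.97)–(1.100)]: `|wC K t a c|·e^{BV K t a h ℓ c} ≤ v K t k (slice …)`
  with the slice envelope `Σ_{c ∈ Csl K k} v K t k c ≤ W K` (`v ≥ 0`);
* (ρ3) «THE PER-MEMBER COUNT» [B16 p. 383 «the summations over the admissible sequences can be replaced by the factors
  exp O(1)(MR_j)^{−d}|Z_j|»]: `#(Dec K w) ≤ ncount (N K) w.2.1` (a product over the member's events of per-event counts)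
  and the SHARE CHECK `N K e ≤ exp (sharpT (φB K) (φR K) e)` (NEEDS-CONSTANT «FIBRE-1»).
The slice set and the envelope may depend on the class (`k`) and the source (`t`); decorations are structural. [folklore] -/
structure IndexDecor (ℛ : HistReading I d) (Φf : HistFactors I d) (l₀ : ℝ) (K₀ : ℕ) (W : ℕ → ℝ)
    (φB : ℕ → ℕ → ℕ → ℝ) (φR : ℕ → ℕ → ℝ) (cellOf : ℕ → HIndex.Idx I → ℕ × Lab d → γ)
    (phys : ℕ → HIndex.Idx I → ℕ × Lab d → δ') (jstar : ℕ → ℕ) (δ κ : Type) where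
  /-- (ρ1) the decoration sets of the key members, per cutoff -/
  Dec : ℕ → γ × Gen PEv × δ' → Finset δ
  /-- (ρ1) the decoration a term writes on a member -/
  dec : ℕ → HIndex.Idx I → γ × Gen PEv × δ' → δ
  /-- (ρ1)∕(ρ2) the slice set of a key class, per cutoff -/
  Csl : ℕ → Finset (γ × Gen PEv × δ') → Finset κ
  /-- (ρ1) the slice of a term (outer summand + curly summand) -/
  slice : ℕ → Finset (γ × Gen PEv × δ') → HIndex.Idx I → κ
  /-- (ρ2) the slice envelope, per cutoff, source and class -/
  v : ℕ → ℝ → Finset (γ × Gen PEv × δ') → κ → ℝ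
  /-- (ρ3) the per-event choice counts, per cutoff -/
  N : ℕ → PEv → ℕ
  /-- display (ρ0): no component of a read term's dissolved process died before the cutoff -/
  died_empty : ∀ K, K₀ ≤ K → ∀ τ ∈ HIndex.termSet I K, ∀ j, j < K → (ℛ.inputOf.run K τ).histV.died j = ∅
  /-- display (ρ1): slices lie in the slice set -/
  hsl : ∀ K, K₀ ≤ K →
    ∀ k ∈ badGMems (memOf ℛ.inputOf.pedV ℛ.inputOf.liveCV cellOf) jstar (HIndex.termSet I)
        (kmemOf ℛ.inputOf.pedV ℛ.inputOf.liveCV cellOf phys) K,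
      ∀ τ ∈ fibre (kmemOf ℛ.inputOf.pedV ℛ.inputOf.liveCV cellOf phys) (HIndex.termSet I) K k, slice K k τ ∈ Csl K k
  /-- display (ρ1): decorations lie in the decoration sets -/
  hmem : ∀ K, K₀ ≤ K →
    ∀ k ∈ badGMems (memOf ℛ.inputOf.pedV ℛ.inputOf.liveCV cellOf) jstar (HIndex.termSet I)
        (kmemOf ℛ.inputOf.pedV ℛ.inputOf.liveCV cellOf phys) K,
      ∀ τ ∈ fibre (kmemOf ℛ.inputOf.pedV ℛ.inputOf.liveCV cellOf phys) (HIndex.termSet I) K k,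
        ∀ w ∈ k, dec K τ w ∈ Dec K w
  /-- display (ρ1): slice and decorations DETERMINE the term of the key fibre -/
  hinj : ∀ K, K₀ ≤ K →
    ∀ k ∈ badGMems (memOf ℛ.inputOf.pedV ℛ.inputOf.liveCV cellOf) jstar (HIndex.termSet I)
        (kmemOf ℛ.inputOf.pedV ℛ.inputOf.liveCV cellOf phys) K,
      ∀ τ ∈ fibre (kmemOf ℛ.inputOf.pedV ℛ.inputOf.liveCV cellOf phys) (HIndex.termSet I) K k,
        ∀ τ' ∈ fibre (kmemOf ℛ.inputOf.pedV ℛ.inputOf.liveCV cellOf phys) (HIndex.termSet I) K k,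
          slice K k τ = slice K k τ' → (∀ w ∈ k, dec K τ w = dec K τ' w) → τ = τ'
  /-- display (ρ2): the slice envelope is nonnegative -/
  v_nonneg : ∀ K t k, ∀ c ∈ Csl K k, 0 ≤ v K t k c
  /-- display (ρ2): THE CURLY ENVELOPE — the exponentiated first-class material of a term is below its slice's envelope -/
  envelope : ∀ K t, |t| ≤ l₀ → K₀ ≤ K →
    ∀ k ∈ badGMems (memOf ℛ.inputOf.pedV ℛ.inputOf.liveCV cellOf) jstar (HIndex.termSet I)
        (kmemOf ℛ.inputOf.pedV ℛ.inputOf.liveCV cellOf phys) K,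
      ∀ (a : (I K).Adm) (h : (I K).HZ) (l : (I K).HL) (c : (I K).HC),
        (⟨K, a, (h, l, c)⟩ : HIndex.Idx I) ∈
            fibre (kmemOf ℛ.inputOf.pedV ℛ.inputOf.liveCV cellOf phys) (HIndex.termSet I) K k →
          |Φf.wC K t a c| * Real.exp (Φf.BV K t a h l c) ≤ v K t k (slice K k ⟨K, a, (h, l, c)⟩)
  /-- display (ρ2): the slice envelopes sum to at most the curly normalisation envelope `W K` -/
  hW : ∀ K t, |t| ≤ l₀ → K₀ ≤ K →
    ∀ k ∈ badGMems (memOf ℛ.inputOf.pedV ℛ.inputOf.liveCV cellOf) jstar (HIndex.termSet I)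
        (kmemOf ℛ.inputOf.pedV ℛ.inputOf.liveCV cellOf phys) K,
      ∑ c ∈ Csl K k, v K t k c ≤ W K
  /-- display (ρ3): a member's decoration set is counted by its genealogy's node count -/
  card_Dec : ∀ K, K₀ ≤ K →
    ∀ k ∈ badGMems (memOf ℛ.inputOf.pedV ℛ.inputOf.liveCV cellOf) jstar (HIndex.termSet I)
        (kmemOf ℛ.inputOf.pedV ℛ.inputOf.liveCV cellOf phys) K,
      ∀ w ∈ k, (Dec K w).card ≤ ncount (N K) w.2.1
  /-- display (ρ3): THE SHARE CHECK «FIBRE-1» — every event's count is within the exponential of its booked share -/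
  hN : ∀ K e, ((N K e : ℕ) : ℝ) ≤ Real.exp (sharpT (φB K) (φR K) e)

/-! ## §2 (ρ0) in the kernel: no dead indices ⇒ the fibre mass of a term IS its exponentiated first-class material -/

section DeadOne

variable (ℛ : HistReading I d) (Φf : HistFactors I d)

/-- under (ρ0) at one term, `dmassOf ℛ Φf t ⟨K, a, (h, ℓ, c)⟩ = |wC K t a c|·e^{BV K t a h ℓ c}` (the dead-part product is
over empty sets). [folklore] -/
theorem dmassOf_eq_of_died_empty {K : ℕ} (t : ℝ) (a : (I K).Adm) (h : (I K).HZ) (l : (I K).HL) (c : (I K).HC)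
    (hdead : ∀ j, j < K → (ℛ.runOf K a (h, l, c)).histV.died j = ∅) :
    dmassOf ℛ Φf t ⟨K, a, (h, l, c)⟩ = |Φf.wC K t a c| * Real.exp (Φf.BV K t a h l c) := by
  rw [dmassOf]
  have h1 : (∏ j ∈ Finset.range K, ∏ x ∈ (ℛ.runOf K a (h, l, c)).histV.died j,
      Real.exp (treeVol (ℛ.runOf K a (h, l, c)).L (ℛ.runOf K a (h, l, c)).s (fun v => (v : ℝ))
          (ℛ.runOf K a (h, l, c)).pedMV (fun j => Real.log (Φf.Λ K j)) j (j, x)) *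
        evProd (Φf.fB K) (Φf.fR K) ((ℛ.runOf K a (h, l, c)).pedMV.toPGen id (j, x))) = 1 :=
    Finset.prod_eq_one fun j hj => by rw [hdead j (Finset.mem_range.1 hj), Finset.prod_empty]
  rw [h1, one_mul]

end DeadOne

/-! ## §3 THE JUNCTION: the display (ρ) `FibreMass` FROM the decoration (M5-5 `fibreMass_of_decoration`, crude count) -/

section Junction

variable {ℛ : HistReading I d} {Φf : HistFactors I d} {l₀ : ℝ} {K₀ : ℕ} {W : ℕ → ℝ} {φB : ℕ → ℕ → ℕ → ℝ}
  {φR : ℕ → ℕ → ℝ} {cellOf : ℕ → HIndex.Idx I → ℕ × Lab d → γ} {phys : ℕ → HIndex.Idx I → ℕ × Lab d → δ'}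
  {jstar : ℕ → ℕ} {δ κ : Type}

/-- **(ρ) `FibreMass` OF THE READING FROM ITS FIBRE DECORATION** (IR-49-1's one-liner, R-OWNER-49-1 (e)): the located
display `hρ` of the (α) records — `∑ τ ∈ fibre kmem T K k, dmassOf ℛ Φf t τ ≤ W K * MULTOf (sharpT (φB K) (φR K)) k`
for every bad key class `k` — FROM (ρ0) (dead part `= 1`), (ρ1) (injective slice + decoration), (ρ2) (curly envelope,
slice sum `≤ W K`) and (ρ3) (decoration sets counted by `ncount`, counts within the booked shares), by the OWNER's
M5-5 `fibreMass_of_decoration` at the CRUDE weights `u := 1` and `card_le_exp_nsum_of_le_ncount`. [folklore] -/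
theorem fibreMass_of_indexDecor (X : IndexDecor ℛ Φf l₀ K₀ W φB φR cellOf phys jstar δ κ) :
    ∀ K t, |t| ≤ l₀ → K₀ ≤ K →
      ∀ k ∈ badGMems (memOf ℛ.inputOf.pedV ℛ.inputOf.liveCV cellOf) jstar (HIndex.termSet I)
          (kmemOf ℛ.inputOf.pedV ℛ.inputOf.liveCV cellOf phys) K,
        ∑ τ ∈ fibre (kmemOf ℛ.inputOf.pedV ℛ.inputOf.liveCV cellOf phys) (HIndex.termSet I) K k,
          dmassOf ℛ Φf t τ ≤ W K * MULTOf (sharpT (φB K) (φR K)) k := by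
  intro K t ht hK k hk
  refine fibreMass_of_decoration (kmemOf ℛ.inputOf.pedV ℛ.inputOf.liveCV cellOf phys) (HIndex.termSet I) K k
    (dmassOf ℛ Φf t) (sharpT (φB K) (φR K)) (X.Dec K) (X.dec K) (X.Csl K k) (X.slice K k) (X.v_nonneg K t k)
    (X.hW K t ht hK k hk) (u := fun _ _ => (1 : ℝ)) (fun _ _ _ _ => zero_le_one) (X.hsl K hK k hk) (X.hmem K hK k hk)
    (X.hinj K hK k hk) (fun τ hτ => ?_) (fun w hw => ?_)
  · -- (ρ0) + (ρ2): the term's mass is its first-class material, below its slice envelope; the crude weights are `1`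
    obtain ⟨hτT, -⟩ := mem_fibre.1 hτ
    obtain ⟨⟨a, h, l, c⟩, -, hpe⟩ := Finset.mem_map.mp hτT
    have hτe : τ = ⟨K, a, (h, l, c)⟩ := hpe.symm
    subst hτe
    rw [Finset.prod_const_one, mul_one,
      dmassOf_eq_of_died_empty ℛ Φf t a h l c (fun j hj => X.died_empty K hK _ hτT j hj)]
    exact X.envelope K t ht hK k hk a h l c hτ
  · -- (ρ3): the crude mass of a member's decoration set is its cardinality, counted by the genealogy
    rw [Finset.sum_const, nsmul_eq_mul, mul_one]
    exact card_le_exp_nsum_of_le_ncount (X.N K) (sharpT (φB K) (φR K)) (X.hN K) (X.card_Dec K hK k hk w hw)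

/-- **THE PURE COUNT OF A KEY FIBRE OF THE READING** (for the census): under (ρ1) without slices — decorations alone
determine the term — and (ρ3), the key fibre of a bad class has at most `MULTOf (sharpT (φB K) (φR K)) k` terms
(M5-5 `card_fibre_le_of_decoration`). [folklore] -/
theorem card_fibre_le_of_indexDecor (X : IndexDecor ℛ Φf l₀ K₀ W φB φR cellOf phys jstar δ κ) {K : ℕ} (hK : K₀ ≤ K)
    {k : Finset (γ × Gen PEv × δ')}
    (hk : k ∈ badGMems (memOf ℛ.inputOf.pedV ℛ.inputOf.liveCV cellOf) jstar (HIndex.termSet I)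
      (kmemOf ℛ.inputOf.pedV ℛ.inputOf.liveCV cellOf phys) K)
    (hinj0 : ∀ τ ∈ fibre (kmemOf ℛ.inputOf.pedV ℛ.inputOf.liveCV cellOf phys) (HIndex.termSet I) K k,
      ∀ τ' ∈ fibre (kmemOf ℛ.inputOf.pedV ℛ.inputOf.liveCV cellOf phys) (HIndex.termSet I) K k,
        (∀ w ∈ k, X.dec K τ w = X.dec K τ' w) → τ = τ') :
    ((fibre (kmemOf ℛ.inputOf.pedV ℛ.inputOf.liveCV cellOf phys) (HIndex.termSet I) K k).card : ℝ) ≤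
      MULTOf (sharpT (φB K) (φR K)) k :=
  card_fibre_le_of_decoration _ _ K k (sharpT (φB K) (φR K)) (X.Dec K) (X.dec K) (X.hmem K hK k hk) hinj0
    fun w hw => card_le_exp_nsum_of_le_ncount (X.N K) (sharpT (φB K) (φR K)) (X.hN K) (X.card_Dec K hK k hk w hw)

end Junction

/-! ## §4 The record-facing instance: `HistReadDataL(W).hρ` VERBATIM at the (α) carriers `cellA`∕`physA`∕`jhalf` -/

section Record

variable {F : T4Family}

/-- **THE FIELD `hρ` OF THE (α) RECORDS, FROM A FIBRE DECORATION OF THE READING** — conclusion LITERALLY the type of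
`HistReadDataL.hρ` ∕ `HistReadDataLW.hρ` (carriers `memA n F.L ℛ`, `kmemA n F.L hn _ ℛ`, cut `jhalf`): the junction
§3 at `cellOf := cellA n F.L ℛ`, `phys := physA n F.L hn _ ℛ`, `jstar := jhalf`. [folklore] -/
theorem hρ_of_indexDecor {n : ℕ} {hn : 0 < n} (ℛ : HistReading I d) (Φf : HistFactors I d) {l₀ : ℝ} {K₀ : ℕ}
    {W : ℕ → ℝ} {φB : ℕ → ℕ → ℕ → ℝ} {φR : ℕ → ℕ → ℝ} {δ κ : Type}
    (X : IndexDecor ℛ Φf l₀ K₀ W φB φR (cellA n F.L ℛ)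
      (physA n F.L hn (lt_of_lt_of_le (by norm_num) (two_le_L F)) ℛ) jhalf δ κ) :
    ∀ K t, |t| ≤ l₀ → K₀ ≤ K →
      ∀ k ∈ badGMems (memA n F.L ℛ) jhalf (HIndex.termSet I)
          (kmemA n F.L hn (lt_of_lt_of_le (by norm_num) (two_le_L F)) ℛ) K,
        ∑ τ ∈ fibre (kmemA n F.L hn (lt_of_lt_of_le (by norm_num) (two_le_L F)) ℛ) (HIndex.termSet I) K k,
          dmassOf ℛ Φf t τ ≤ W K * MULTOf (sharpT (φB K) (φR K)) k :=
  fibreMass_of_indexDecor X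

end Record

end

end Summit.QuantumFields.BalabanUV.T4Continuum.HistoryRealiseCellsRunSupplyFibreWTVS
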